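import Summits.ABC.ABC.Theorems.ThetaPartII.Negative.StubHullRegimeAboveFalseOfDeepLopsidedDatum
import Literature.IUT.LogVolume.GenuineLogThetaPointDegrees
import HarnessLib

/-!
# Crux `ThetaPartII` (stmt-ABC-19678), (U) line: `stub_hullRegimeAbove` is false modulo ONE deep lopsided admissible
# datum — the antecedent in the vocabulary of the `λ`-line point `(P, l)` alone ([IUTchIV] Thm. 1.10 Step (v))

Record-only PROOF file (D-0012) of the abc-iut cell (campaign-S seat abc-iut-S4, gen 6); TAKES NO SIDE on [IUTchIII]
Cor. 3.12, on [IUTchIV] Thm. 1.10, or on the (U)/(P) readings of "`−|log(Θ)|`". Companion of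
`Negative/StubHullRegimeAboveFalseOfDeepLopsidedDatum` (p445919): there the antecedent of the negative lemma is phrased
with the datum's own invariants `ℓ⋇ = T.I.X.lstar` and `[F_mod:ℚ] = finrank ℚ (fieldOfModuli E_F)`. At a genuine
Θ-volume datum `T : Cor22.ThetaVolumeDatumAt P l` both are functions of `(P, l)`: `[F_mod:ℚ] = d_mod(P)`
(abc-iut-L5-t3's `Cor22.ThetaVolumeDatumAt.finrank_rat_fieldOfModuli_eq_dmod`, from `j(E_F) = j(λ)`) and `ℓ⋇ = (l−1)/2`
(the input is a volume input OF the initial Θ-data `T.D`: `T.isVolumeInputOf.X_eq` and abc-iut-c312-7's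
`Thm311.Real.l_eq_two_mul_lstarOf_add_one`). Substituting, `(ℓ⋇+3)/2 = (l+5)/4` and `(ℓ⋇+1)(2ℓ⋇+1)/6 = l(l+1)/12`, so
the negative lemma reads (`stub_hullRegimeAbove_false_of_deepLopsidedDatum_explicit`): IF some admissible `(P, l)` in the
registered regime with `4·d_mod ≤ l + 5` carries a genuine datum `T` that is not slot-constant and a support prime `p`
with places `v, w` of `F_mod` over `p` such that
`B(P,l) − ((l+5)/4 − d_mod)·(log-diff(λ) + (1 − 1/l)·log 𝔣^{F_tpd}_{∤2l}) < Pr(v)·Pr(w)·(l(l+1)/12)·(μ(v) − μ(w))`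
(`μ(u) = P_q(u)·ln N(u)/n_u`, `Pr(u) = n_u/[F_mod:ℚ]`, `B(P,l)` print's Step (viii) constant as registered), THEN the
registered `stub_hullRegimeAbove` is false. Every quantity on the left is a function of the point `λ` and `l`; the
right side is read off the `q`-pilot divisor of the datum at ONE split support prime. The antecedent is a HYPOTHESIS
(an explicit arithmetic existence statement), NOT asserted; whether a certificate of (P2)/(P5)/(P6) can be produced at a
point of the required height is a computational question not settled here. This does NOT refute the crux `ThetaPartII`,
the route, or [IUTchIV] Thm. 1.10 (the (P) line's volume stub is a theorem, abc-iut-c312-d1 p425589).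
[cite: Mochizuki2012, IUTchIV Thm. 1.10 Step (v) p. 27–29] [cite: DupuyHilado2025, §4.7, §4.12]
[claim: Mochizuki2012, status: disputed] for every IUT quotation. PROOF-ONLY file.
-/

noncomputable section

-- `Summit.<Summit>.<Problem>` is the mandated summit-side namespace (CONVENTIONS §2); for the
-- single-conjunct summit `ABC` the two coincide, so the duplicate `ABC.ABC` is deliberate.
set_option linter.dupNamespace false

namespace Summit.ABC.ABC.Theorems.ThetaPartII.Negative

open Literature.NumberTheory.DiophantineGeometry.GenEll Literature.IUT.LogVolume Literature.IUT.HodgeTheaters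
open Summit.ABC.IUTFork NumberField IsDedekindDomain

/-- **`ℓ⋇ = (l−1)/2` at a genuine Θ-volume datum** (as a real number): the pilot data of the datum's input are those of
the initial Θ-data `T.D` (`T.isVolumeInputOf.X_eq`), whose procession length is `(l−1)/2` with `l = 2·ℓ⋇ + 1`
([IUTchI] Def. 3.1 (c)). [cite: Mochizuki2012, IUTchI Def. 3.1 (c) p. 61] -/
theorem lstar_cast_eq_of_datum {P : NFPoint} {l : ℕ} (T : Cor22.ThetaVolumeDatumAt P l) :
    (letI := T.instFieldF; letI := T.instNumberFieldF; letI := T.instFieldK; letI := T.instNumberFieldK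
     letI := T.instAlgebraK; letI := T.instIsElliptic; ((T.I.X.lstar : ℕ) : ℝ)) = ((l : ℝ) - 1) / 2 := by
  letI := T.instFieldF; letI := T.instNumberFieldF; letI := T.instAlgebraF; letI := T.instFieldK
  letI := T.instNumberFieldK; letI := T.instAlgebraK; letI := T.instFieldFbar; letI := T.instAlgebraFbar
  letI := T.instAlgebraKFbar; letI := T.instIsElliptic
  have hX : T.I.X.lstar = Thm311.Real.lstarOf T.D := by rw [T.isVolumeInputOf.X_eq]; rfl
  have hl : l = 2 * Thm311.Real.lstarOf T.D + 1 := Thm311.Real.l_eq_two_mul_lstarOf_add_one T.D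
  have hlR : (l : ℝ) = 2 * (Thm311.Real.lstarOf T.D : ℝ) + 1 := by exact_mod_cast hl
  change ((T.I.X.lstar : ℕ) : ℝ) = ((l : ℝ) - 1) / 2
  rw [hX, hlR]; ring

/-- **`stub_hullRegimeAbove` is false modulo ONE deep lopsided admissible datum — `(P, l)`-explicit antecedent.** If some
admissible `(P, l)` in the regime of the registered stub (`λ ∈ U_P`, `l ≥ 5` prime, `AdmitsCore`, (P2), (P5), (P6),
`2 ≤ d_mod`, above abc-iut-c312-d1's threshold) with `4·d_mod ≤ l + 5` carries a genuine Θ-volume datum `T` that is not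
slot-constant, and a support prime `p` with places `v, w` of `F_mod` over `p` such that
`B(P,l) − ((l+5)/4 − d_mod)·(log-diff(λ) + (1 − 1/l)·log 𝔣^{F_tpd}_{∤2l}) < Pr(v)·Pr(w)·(l(l+1)/12)·(μ(v) − μ(w))`, then the
statement registered as `stub_hullRegimeAbove` fails. Reduction to `stub_hullRegimeAbove_false_of_deepLopsidedDatum` by
`[F_mod:ℚ] = d_mod` (`finrank_rat_fieldOfModuli_eq_dmod`) and `ℓ⋇ = (l−1)/2` (`lstar_cast_eq_of_datum`). An implication;
its antecedent is NOT asserted. No side taken. [cite: Mochizuki2012, IUTchIV Thm. 1.10 Step (v) p. 27–29]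
[claim: Mochizuki2012, status: disputed] -/
theorem stub_hullRegimeAbove_false_of_deepLopsidedDatum_explicit
    (H : ∃ (P : NFPoint) (_ : P ∈ UP) (l : ℕ) (_ : l.Prime) (_ : 5 ≤ l) (_ : Cor22.AdmitsCore P)
        (_ : Cor22.CondP2 P l) (_ : Cor22.CondP5 P l) (_ : Cor22.CondP6 P l) (_ : 2 ≤ Cor22.dmod P)
        (_ : 40 * Real.log (((2 ^ 12 * 3 ^ 3 * 5 * Cor22.dmod P : ℕ) : ℝ) * l)
          * ((Nat.primeCounting (2 ^ 12 * 3 ^ 3 * 5 * Cor22.dmod P * l) : ℝ)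
            - (2 * (Cor22.dmod P : ℝ) * (P.logDiff + Cor22.logCondAvoid P {2, l}) + Real.log (2 * 3 * 5 * (l : ℝ)))
              / Real.log 2) < Cor22.logQAvoid P {2, l})
        (_ : 4 * Cor22.dmod P ≤ l + 5)
        (T : Cor22.ThetaVolumeDatumAt P l),
        (letI := T.instFieldF; letI := T.instNumberFieldF; letI := T.instAlgebraF; letI := T.instFieldK
         letI := T.instNumberFieldK; letI := T.instAlgebraK; letI := T.instFieldFbar; letI := T.instAlgebraFbar
         letI := T.instAlgebraKFbar; letI := T.instIsElliptic
         ¬ (∀ p ∈ T.I.supportPrimes, ∀ v w : placesOver (fieldOfModuli T.E) p,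
            (DHData.ofInput T.I).logQloc p v = (DHData.ofInput T.I).logQloc p w) ∧
         ∃ (p : ℕ) (hp : p.Prime) (_ : p ∈ T.I.supportPrimes),
           haveI : Fact p.Prime := ⟨hp⟩
           ∃ v w : placesOver (fieldOfModuli T.E) p,
             ((l : ℝ) + 1) / 4 *
                 ((1 + 12 * (Cor22.dmod P : ℝ) / l) * (P.logDiff + Cor22.logCondAvoid P {2, l})
                   + 2 * Real.log l + 52
                   + 20 / 3 * Real.log (((2 ^ 12 * 3 ^ 3 * 5 * Cor22.dmod P : ℕ) : ℝ) * (l : ℝ))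
                     * (Nat.primeCounting (2 ^ 12 * 3 ^ 3 * 5 * Cor22.dmod P * l) : ℝ))
               - (((l : ℝ) + 5) / 4 - (Cor22.dmod P : ℝ)) *
                   (P.logDiff + (1 - 1 / (l : ℝ)) * Cor22.logCondAvoid P {2, l}) <
             weight (fieldOfModuli T.E) v.1 * weight (fieldOfModuli T.E) w.1 * ((l : ℝ) * ((l : ℝ) + 1) / 12) *
               (T.I.X.qPilot v.1 * logNorm (fieldOfModuli T.E) v.1 / (localDegree (fieldOfModuli T.E) v.1 : ℝ)
                 - T.I.X.qPilot w.1 * logNorm (fieldOfModuli T.E) w.1 /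
                   (localDegree (fieldOfModuli T.E) w.1 : ℝ)))) :
    ¬ (∀ P : NFPoint, P ∈ UP → ∀ l : ℕ, l.Prime → 5 ≤ l →
        Cor22.AdmitsCore P → Cor22.CondP2 P l → Cor22.CondP5 P l → Cor22.CondP6 P l →
        2 ≤ Cor22.dmod P →
        40 * Real.log (((2 ^ 12 * 3 ^ 3 * 5 * Cor22.dmod P : ℕ) : ℝ) * l)
          * ((Nat.primeCounting (2 ^ 12 * 3 ^ 3 * 5 * Cor22.dmod P * l) : ℝ)
            - (2 * (Cor22.dmod P : ℝ) * (P.logDiff + Cor22.logCondAvoid P {2, l}) + Real.log (2 * 3 * 5 * (l : ℝ)))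
              / Real.log 2) < Cor22.logQAvoid P {2, l} →
        ∀ T : Cor22.ThetaVolumeDatumAt P l,
          (letI := T.instFieldF; letI := T.instNumberFieldF; letI := T.instAlgebraF; letI := T.instFieldK
           letI := T.instNumberFieldK; letI := T.instAlgebraK; letI := T.instFieldFbar; letI := T.instAlgebraFbar
           letI := T.instAlgebraKFbar; letI := T.instIsElliptic
           ¬ (∀ p ∈ T.I.supportPrimes, ∀ v w : placesOver (fieldOfModuli T.E) p,
              (DHData.ofInput T.I).logQloc p v = (DHData.ofInput T.I).logQloc p w)) →
          T.HullEstimateOf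
            (((l : ℝ) + 1) / 4 *
              ((1 + 12 * (Cor22.dmod P : ℝ) / l) * (P.logDiff + Cor22.logCondAvoid P {2, l})
                + 2 * Real.log l + 52
                + 20 / 3 * Real.log (((2 ^ 12 * 3 ^ 3 * 5 * Cor22.dmod P : ℕ) : ℝ) * (l : ℝ))
                  * (Nat.primeCounting (2 ^ 12 * 3 ^ 3 * 5 * Cor22.dmod P * l) : ℝ)))) := by
  refine stub_hullRegimeAbove_false_of_deepLopsidedDatum ?_
  obtain ⟨P, hP, l, hl, h5, hcore, h2, h5', h6, hd2, hthr, hdl, T, hrest⟩ := H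
  letI := T.instFieldF; letI := T.instNumberFieldF; letI := T.instAlgebraF; letI := T.instFieldK
  letI := T.instNumberFieldK; letI := T.instAlgebraK; letI := T.instFieldFbar; letI := T.instAlgebraFbar
  letI := T.instAlgebraKFbar; letI := T.instIsElliptic
  obtain ⟨hnsc, p, hp, hpT, v, w, hlt⟩ := hrest
  haveI : Fact p.Prime := ⟨hp⟩
  -- the datum's invariants are functions of `(P, l)`
  have hfin : (Module.finrank ℚ (fieldOfModuli T.E) : ℝ) = (Cor22.dmod P : ℝ) := by
    exact_mod_cast T.finrank_rat_fieldOfModuli_eq_dmod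
  have hls : ((T.I.X.lstar : ℕ) : ℝ) = ((l : ℝ) - 1) / 2 := lstar_cast_eq_of_datum T
  have hdlR : (4 : ℝ) * (Cor22.dmod P : ℝ) ≤ (l : ℝ) + 5 := by exact_mod_cast hdl
  have e1 : ((T.I.X.lstar : ℝ) + 3) / 2 = ((l : ℝ) + 5) / 4 := by rw [hls]; ring
  have e2 : (((T.I.X.lstar : ℝ) + 1) * (2 * T.I.X.lstar + 1)) / 6 = (l : ℝ) * ((l : ℝ) + 1) / 12 := by
    rw [hls]; ring
  refine ⟨P, hP, l, hl, h5, hcore, h2, h5', h6, hd2, hthr, T, hnsc, ?_, p, hp, hpT, v, w, ?_⟩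
  · change (Module.finrank ℚ (fieldOfModuli T.E) : ℝ) ≤ ((T.I.X.lstar : ℝ) + 3) / 2
    rw [e1, hfin]; linarith
  · change _ - (((T.I.X.lstar : ℝ) + 3) / 2 - Module.finrank ℚ (fieldOfModuli T.E)) * _ <
      weight (fieldOfModuli T.E) v.1 * weight (fieldOfModuli T.E) w.1 *
        ((((T.I.X.lstar : ℝ) + 1) * (2 * T.I.X.lstar + 1)) / 6) * _
    rw [e1, e2, hfin]; exact hlt

end Summit.ABC.ABC.Theorems.ThetaPartII.Negative

end
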